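import Literature.MathematicalPhysics.QuantumLattice.GrassmannGaussianQuadraticInsertion
import Literature.MathematicalPhysics.QuantumLattice.GrassmannPairLaplacians
import Literature.MathematicalPhysics.QuantumLattice.GrassmannFlowIteration
import Literature.MathematicalPhysics.QuantumLattice.GrassmannBerezinLaplacianBridge
import Mathlib.Analysis.Calculus.Deriv.Mul
import Mathlib.Analysis.Calculus.Deriv.Inv
import Mathlib.Analysis.Calculus.Deriv.Add
import HarnessLib

/-!
# Salmhofer's renormalization group equation on a finite Grassmann algebra (Polchinski's equation)

Topic `MathematicalPhysics/QuantumLattice`; generic layer over `GrassmannLaplacian.lean` (`grassmannDeriv`,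
`grassmannLaplacian R C = Δ_C`, `gaussConv R C = e^{Δ_C}`) and `GrassmannEffectiveAction.lean`
(`effBoltzmann = μ_C ⋆ e^{-V}`, `effPartitionFn = Z`, `effAction`), whose module docstring lists "Not here: … the
RG differential equation (4.89)".  This file proves it: **M. Salmhofer, Commun. Math. Phys. 194 (1998) 249,
§3.1 Proposition 1** (= *Renormalization: An Introduction* (1999), Prop. 4.3, (4.86)–(4.89)), for a finite
label set `Γ` and an entrywise differentiable covariance `t ↦ C_t` (derivative `Ċ_t`; `t` in a normed field
`𝕂`, coefficients in `𝕜 = ℝ` or `ℂ`):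

* (Geffdif)/(4.87) `∂_t e^{𝒢(t,ψ)} = Δ̇_{C_t} e^{𝒢(t,ψ)}` — `hasCoeffDerivAt_gaussConv_apply` (any `F` in place of
  `e^{𝒢(0,ψ)}`), `hasCoeffDerivAt_effBoltzmann_flow`, and for the partition function
  `hasDerivAt_effPartitionFn_flow`;
* (Geff3)/(4.88) `e^{𝒢(t,ψ)} = e^{Δ_{C_t}} e^{𝒢(0,ψ)}` — in the tree this is the DEFINITION of the Grassmann Gaussian
  convolution (`gaussConv_def`, `effBoltzmann_def`; the identification with the two-field Berezin integral
  `∫ dμ_{C_t}(χ) e^{𝒢(0,χ+ψ)}` is Salmhofer 1999 Prop. 4.3, see `GrassmannLaplacian.lean`, Design), so nothing is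
  restated;
* parity: "`𝒢(t,ψ)` is an element of the even subalgebra" — the tree's `effAction_mem_evenPart`
  (`GrassmannFlowIteration.lean`), cited not restated;
* (RGE)/(4.89) `∂_t 𝒢(t,ψ) = Δ̇_{C_t} 𝒢(t,ψ) + ½ (δ𝒢/δψ, Ċ_t δ𝒢/δψ)_Γ` — `hasCoeffDerivAt_salmhofer_rge` for
  `𝒢 = c − 𝒱` (`𝒱 = effAction`, `c` any first-order logarithm of `Z`), and, split into field-dependent and
  constant parts, `hasCoeffDerivAt_effAction_flow`:
  `∂_t 𝒱 = Δ_{Ċ}𝒱 − ½(δ𝒱/δψ, Ċ δ𝒱/δψ) − [Δ_{Ċ}𝒱 − ½(δ𝒱/δψ, Ċ δ𝒱/δψ)]_∅`, `Ż = −Z [Δ_{Ċ}𝒱 − ½(δ𝒱/δψ, Ċ δ𝒱/δψ)]_∅`.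

Everything is proved (kernel-checked, zero `sorry`); two definitions (`GrassmannAlgebra.HasCoeffDerivAt`,
`grassmannDerivPairing`), NO named fact.  The §1–§2 lemmas are elementary (finite-dimensional calculus, degree
counting); their cite tags point to the step of the printed proof they serve, per the Literature citation lint.
Statement-level vocabulary only: nothing here is a claim about the Hubbard model or about superconductivity.

## Contents

* §1 `GrassmannAlgebra.HasCoeffDerivAt X X' t` — the derivative of a curve `X : 𝕂 → Λ(Γ)` COEFFICIENTWISE in the
  monomial basis `grassmannBasis` (the finite-dimensional meaning of `∂_t`; mirror of `CoeffRegular` of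
  `GrassmannCoefficientRegularity.lean`), with its calculus: `add/neg/sub/sum/smul/const_smul/rat_smul`, every
  linear functional / linear map (`apply`, `linearMap`), the product rule `mul` (via `repr_mul_eq_sum`), the power
  rule `pow` for a base commuting with its derivative, parity and constant part of the derivative (`mem_evenOdd`,
  `constPart_eq_zero`), and the chain rules `grassmannExp` (`(e^X)' = e^X X'`) and `grassmannLog1p`
  (`(log(1+X))' = (1+X)⁻¹ X'`, the inverse being the finite geometric sum, `one_add_mul_neg_geom_sum_eq_one`) along
  EVEN curves without constant part (even elements are central, `commute_of_mem_evenOdd_zero`).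
* §2 **uniform nilpotency** `grassmannLaplacian_pow_card_succ_eq_zero : Δ_C ^ (|Γ|+1) = 0` for every `C` (via
  `Δ_C (⋀^{k+2}) ⊆ ⋀^k`), hence the FIXED-length exponential sum `gaussConv_eq_sum_range` — what a `t`-dependent
  covariance needs.
* §3 (4.87): `HasCoeffDerivAt.grassmannLaplacian` (`(Δ_{B(r)} H(r))' = Δ_{B'} H + Δ_B H'`),
  `hasCoeffDerivAt_gaussConv_apply` (`(e^{Δ_{C_r}} F)' = Δ_{Ċ} e^{Δ_{C_t}} F`, proof: `e^{Δ_{C_r}} = e^{Δ_{C_r − C_t}} e^{Δ_{C_t}}`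
  by `gaussConv_add`, then first order of the fixed-length sum), `HasCoeffDerivAt.gaussConv` (differentiable argument).
* §4 `grassmannDerivPairing R C a b = Σ_{X,Y} ∂_X a · C(X,Y) · ∂_Y b` (Salmhofer's `(δa/δψ, C δb/δψ)_Γ`) and
  `grassmannLaplacian_grassmannExp`: `Δ_C e^{g} = e^{g}(Δ_C g + ½(δg/δψ, C δg/δψ))` for even nilpotent `g` ("performing
  the derivatives with respect to `ψ`"); the `ℂ`-specialisation of the latter also appears problem-side
  (`…Theorems.AposterioriCapRgSeededBrokenRegimeBoseFermiPinnedSeedWardAction`, not importable here).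
* §5 (4.89): `hasCoeffDerivAt_effBoltzmann_flow`, `hasDerivAt_effPartitionFn_flow`, `hasCoeffDerivAt_effAction_flow`,
  `hasCoeffDerivAt_salmhofer_rge`.

## Sources

M. Salmhofer, *Continuous renormalization for fermions and Fermi liquid theory*, Commun. Math. Phys. **194**
(1998) 249–295, §3.1 "The effective action and the RGE", Proposition 1 with proof (arXiv:cond-mat/9706188;
held TeX render `paper:arxiv-cond-mat_9706188`, chunk p0011 L62–L139: statement L62–L93, proof L95–L139); bib key
`Salmhofer1998`.  M. Salmhofer, *Renormalization: An Introduction* (Springer 1999), §4.3.1–4.3.2, (4.85)–(4.91),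
Proposition 4.3 (held copy `book:salmhofer1999-renormalization-introduction`, PDF pp. 119–120); bib key
`Salmhofer1999`.

## Design / deviations (disclosed)

* `∂_t` of a `Λ(Γ)`-valued curve is taken COEFFICIENTWISE (equivalently: through every `𝕜`-linear functional,
  `HasCoeffDerivAt.apply`); `Λ(Γ)` carries no norm in the tree and none is introduced (no instances).  This needs a
  linear order on `Γ` (for `grassmannBasis`), as in `GrassmannCoefficientRegularity.lean`.
* Salmhofer's `𝒢(t,ψ)` keeps its constant part `log Z_t`; the tree's `effAction` is normalised (`[𝒱]_∅ = 0`,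
  `e^{𝒢} = Z e^{-𝒱}`, `effBoltzmann_eq_smul_grassmannExp`).  (4.89) is therefore proved (i) for `𝒱` with the constant
  `[·]_∅` subtracted plus the scalar equation for `Z`, and (ii) verbatim for `𝒢 = c − 𝒱` with `c` ANY scalar function
  whose derivative at `t` is `Ż_t/Z_t` (a logarithm of `Z` to first order; no branch of `log` is chosen).  As in
  (4.85), `V` is even without constant part; the only analytic hypothesis is `Z_t ≠ 0` AT `t` (then `Z ≠ 0` near `t`
  by continuity — Salmhofer: "`e^{𝒢} = 1` for `λ = 0`", so this holds for small `λ`).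
* Salmhofer's weights `∫_Γ dX = ε_Γ Σ_X`, `δ/δψ = ε_Γ⁻¹ ∂/∂ψ` cancel in `Δ_C` and in `(δ𝒢/δψ, Ċ δ𝒢/δψ)_Γ`, so plain
  sums and left derivatives are used (as in `GrassmannLaplacian.lean`); `Δ̇_{C_t} = Δ_{Ċ_t}` by linearity of
  `C ↦ Δ_C` (`grassmannLaplacian_add/smul`).
* NOT here: §3.2 Proposition 2 (the component RGE in Wick-ordered coordinates, (4.93)–(4.95) / Salmhofer 1998
  (Qrmtdef)) and Appendix A (Wick ordering) — they need the Wick-ordered monomial basis; the typed component-RGE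
  predicates are in `FermiRG/Salmhofer1998Sec2.lean` (`IsRGESolution`).
-/

noncomputable section

namespace Literature.MathematicalPhysics.QuantumLattice

open GrassmannAlgebra Finset
open scoped Nat Topology

/-! ## §1 Coefficientwise derivatives of curves in a finite Grassmann algebra -/

section CoeffDeriv

namespace GrassmannAlgebra

variable {𝕂 : Type*} [NontriviallyNormedField 𝕂] {𝕜 : Type*} [RCLike 𝕜] [NormedAlgebra 𝕂 𝕜]
variable {Γ : Type*} [LinearOrder Γ] [Fintype Γ]

/-- **Coefficientwise derivative of a curve in the Grassmann algebra.**  `HasCoeffDerivAt X X' t` says that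
every monomial coefficient `r ↦ [θ_s] X(r)` has derivative `[θ_s] X'` at `r = t` (the finite-dimensional,
basis-wise meaning of `∂_t X(t) = X'`, Salmhofer 1998, §3.1: "`𝒜` is a finite-dimensional Grassmann algebra").
[cite: Salmhofer1998, §3.1 Prop. 1 proof (p.11; render p0011:L95-L139)] -/
def HasCoeffDerivAt (X : 𝕂 → GrassmannAlgebra 𝕜 Γ) (X' : GrassmannAlgebra 𝕜 Γ) (t : 𝕂) : Prop :=
  ∀ s : Finset Γ, HasDerivAt (fun r => (grassmannBasis 𝕜 Γ).repr (X r) s) ((grassmannBasis 𝕜 Γ).repr X' s) t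

variable {X Y : 𝕂 → GrassmannAlgebra 𝕜 Γ} {X' Y' : GrassmannAlgebra 𝕜 Γ} {t : 𝕂}

/-- A constant curve has derivative `0`. [cite: Salmhofer1998, §3.1 Prop. 1 proof (p.11; render p0011:L95-L139)] -/
theorem hasCoeffDerivAt_const (a : GrassmannAlgebra 𝕜 Γ) (t : 𝕂) : HasCoeffDerivAt (fun _ : 𝕂 => a) 0 t :=
  fun s => by
    rw [map_zero, Finsupp.zero_apply]
    exact hasDerivAt_const t _

namespace HasCoeffDerivAt

/-- Curves agreeing near `t` have the same derivative there. [cite: Salmhofer1998, §3.1 Prop. 1 proof (p.11; render p0011:L95-L139)] -/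
theorem congr_of_eventuallyEq (h : HasCoeffDerivAt X X' t) (hY : Y =ᶠ[𝓝 t] X) : HasCoeffDerivAt Y X' t :=
  fun s => (h s).congr_of_eventuallyEq (hY.mono fun r hr => by simp only [hr])

/-- Sum rule. [cite: Salmhofer1998, §3.1 Prop. 1 proof (p.11; render p0011:L95-L139)] -/
theorem add (hX : HasCoeffDerivAt X X' t) (hY : HasCoeffDerivAt Y Y' t) :
    HasCoeffDerivAt (fun r => X r + Y r) (X' + Y') t := fun s => by
  simp only [map_add, Finsupp.add_apply]
  exact (hX s).add (hY s)

/-- Negation. [cite: Salmhofer1998, §3.1 Prop. 1 proof (p.11; render p0011:L95-L139)] -/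
theorem neg (hX : HasCoeffDerivAt X X' t) : HasCoeffDerivAt (fun r => -X r) (-X') t := fun s => by
  simp only [map_neg, Finsupp.neg_apply]
  exact (hX s).neg

/-- Difference rule. [cite: Salmhofer1998, §3.1 Prop. 1 proof (p.11; render p0011:L95-L139)] -/
theorem sub (hX : HasCoeffDerivAt X X' t) (hY : HasCoeffDerivAt Y Y' t) :
    HasCoeffDerivAt (fun r => X r - Y r) (X' - Y') t := fun s => by
  simp only [map_sub, Finsupp.sub_apply]
  exact (hX s).sub (hY s)

/-- Finite sums. [cite: Salmhofer1998, §3.1 Prop. 1 proof (p.11; render p0011:L95-L139)] -/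
theorem sum {K : Type*} (u : Finset K) {X : K → 𝕂 → GrassmannAlgebra 𝕜 Γ} {X' : K → GrassmannAlgebra 𝕜 Γ}
    (h : ∀ k ∈ u, HasCoeffDerivAt (X k) (X' k) t) :
    HasCoeffDerivAt (fun r => ∑ k ∈ u, X k r) (∑ k ∈ u, X' k) t := fun s => by
  simp only [map_sum, Finsupp.finsetSum_apply]
  exact HasDerivAt.fun_sum fun k hk => h k hk s

/-- Product with a differentiable scalar function: `(c X)' = c' X + c X'`. [cite: Salmhofer1998, §3.1 Prop. 1 proof (p.11; render p0011:L95-L139)] -/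
theorem smul {c : 𝕂 → 𝕜} {c' : 𝕜} (hc : HasDerivAt c c' t) (hX : HasCoeffDerivAt X X' t) :
    HasCoeffDerivAt (fun r => c r • X r) (c' • X t + c t • X') t := fun s => by
  simp only [map_smul, map_add, Finsupp.add_apply, Finsupp.smul_apply, smul_eq_mul]
  exact hc.mul (hX s)

/-- A differentiable scalar function times a fixed element. [cite: Salmhofer1998, §3.1 Prop. 1 proof (p.11; render p0011:L95-L139)] -/
theorem _root_.Literature.MathematicalPhysics.QuantumLattice.GrassmannAlgebra.hasCoeffDerivAt_smul_const
    {c : 𝕂 → 𝕜} {c' : 𝕜} (hc : HasDerivAt c c' t) (a : GrassmannAlgebra 𝕜 Γ) :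
    HasCoeffDerivAt (fun r => c r • a) (c' • a) t := fun s => by
  simp only [map_smul, Finsupp.smul_apply, smul_eq_mul]
  exact hc.mul_const _

/-- Constant scalar multiples. [cite: Salmhofer1998, §3.1 Prop. 1 proof (p.11; render p0011:L95-L139)] -/
theorem const_smul (hX : HasCoeffDerivAt X X' t) (c : 𝕜) :
    HasCoeffDerivAt (fun r => c • X r) (c • X') t := fun s => by
  simp only [map_smul, Finsupp.smul_apply, smul_eq_mul]
  exact (hX s).const_mul c

/-- Constant rational multiples (the coefficients of `exp` and `log`). [cite: Salmhofer1998, §3.1 Prop. 1 proof (p.11; render p0011:L95-L139)] -/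
theorem rat_smul (hX : HasCoeffDerivAt X X' t) (q : ℚ) :
    HasCoeffDerivAt (fun r => q • X r) (q • X') t := by
  have h := hX.const_smul (q : 𝕜)
  simp only [Rat.cast_smul_eq_qsmul] at h
  exact h

/-- **Every linear functional of a differentiable curve is differentiable**, with derivative the
functional of the derivative. [cite: Salmhofer1998, §3.1 Prop. 1 proof (p.11; render p0011:L95-L139)] -/
theorem apply (hX : HasCoeffDerivAt X X' t) (lam : GrassmannAlgebra 𝕜 Γ →ₗ[𝕜] 𝕜) :
    HasDerivAt (fun r => lam (X r)) (lam X') t := by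
  have key : ∀ x : GrassmannAlgebra 𝕜 Γ,
      lam x = ∑ s, (grassmannBasis 𝕜 Γ).repr x s * lam (grassmannBasis 𝕜 Γ s) := fun x => by
    conv_lhs => rw [← (grassmannBasis 𝕜 Γ).sum_repr x]
    simp only [map_sum, map_smul, smul_eq_mul]
  rw [key X', show (fun r => lam (X r)) = fun r => ∑ s, (grassmannBasis 𝕜 Γ).repr (X r) s *
      lam (grassmannBasis 𝕜 Γ s) from funext fun r => key _]
  exact HasDerivAt.fun_sum fun s _ => (hX s).mul_const _

/-- Fixed linear maps (between Grassmann algebras) commute with differentiation. [cite: Salmhofer1998, §3.1 Prop. 1 proof (p.11; render p0011:L95-L139)] -/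
theorem linearMap {Γ' : Type*} [LinearOrder Γ'] [Fintype Γ'] (hX : HasCoeffDerivAt X X' t)
    (L : GrassmannAlgebra 𝕜 Γ →ₗ[𝕜] GrassmannAlgebra 𝕜 Γ') :
    HasCoeffDerivAt (fun r => L (X r)) (L X') t := fun s => by
  have h := hX.apply (((grassmannBasis 𝕜 Γ').coord s) ∘ₗ L)
  simpa only [LinearMap.comp_apply, Module.Basis.coord_apply] using h

omit [NontriviallyNormedField 𝕂] [NormedAlgebra 𝕂 𝕜] in
/-- The coefficient of a product, bilinearly expanded on the monomial basis. [cite: Salmhofer1998, §3.1 Prop. 1 proof (p.11; render p0011:L95-L139)] -/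
theorem _root_.Literature.MathematicalPhysics.QuantumLattice.GrassmannAlgebra.repr_mul_eq_sum
    (x y : GrassmannAlgebra 𝕜 Γ) (s : Finset Γ) :
    (grassmannBasis 𝕜 Γ).repr (x * y) s = ∑ u, ∑ v, (grassmannBasis 𝕜 Γ).repr x u *
      (grassmannBasis 𝕜 Γ).repr y v * (grassmannBasis 𝕜 Γ).repr (grassmannBasis 𝕜 Γ u * grassmannBasis 𝕜 Γ v) s := by
  conv_lhs => rw [← (grassmannBasis 𝕜 Γ).sum_repr x, ← (grassmannBasis 𝕜 Γ).sum_repr y, Finset.sum_mul_sum]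
  simp only [map_sum, Finsupp.finsetSum_apply, smul_mul_smul_comm, map_smul, Finsupp.smul_apply,
    smul_eq_mul, mul_assoc]

/-- **Product rule** `(X Y)' = X' Y + X Y'` (no commutativity needed). [cite: Salmhofer1998, §3.1 Prop. 1 proof (p.11; render p0011:L95-L139)] -/
theorem mul (hX : HasCoeffDerivAt X X' t) (hY : HasCoeffDerivAt Y Y' t) :
    HasCoeffDerivAt (fun r => X r * Y r) (X' * Y t + X t * Y') t := fun s => by
  have h := HasDerivAt.fun_sum (u := Finset.univ) fun u _ => HasDerivAt.fun_sum (u := Finset.univ) fun v _ =>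
    ((hX u).mul (hY v)).mul_const ((grassmannBasis 𝕜 Γ).repr (grassmannBasis 𝕜 Γ u * grassmannBasis 𝕜 Γ v) s)
  rw [show (fun r => (grassmannBasis 𝕜 Γ).repr (X r * Y r) s) = fun r => ∑ u, ∑ v,
      (grassmannBasis 𝕜 Γ).repr (X r) u * (grassmannBasis 𝕜 Γ).repr (Y r) v *
        (grassmannBasis 𝕜 Γ).repr (grassmannBasis 𝕜 Γ u * grassmannBasis 𝕜 Γ v) s from
    funext fun r => repr_mul_eq_sum _ _ _]
  refine h.congr_deriv ?_
  rw [map_add, Finsupp.add_apply, repr_mul_eq_sum X' (Y t) s, repr_mul_eq_sum (X t) Y' s,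
    ← Finset.sum_add_distrib]
  refine Finset.sum_congr rfl fun u _ => ?_
  rw [← Finset.sum_add_distrib]
  refine Finset.sum_congr rfl fun v _ => ?_
  ring

/-- **Power rule** for a base commuting with its derivative: `(X^{n+1})' = (n+1) X^n X'`. [cite: Salmhofer1998, §3.1 Prop. 1 proof (p.11; render p0011:L95-L139)] -/
theorem pow (hX : HasCoeffDerivAt X X' t) (hc : Commute (X t) X') (n : ℕ) :
    HasCoeffDerivAt (fun r => X r ^ (n + 1)) ((n + 1) • (X t ^ n * X')) t := by
  induction n with
  | zero =>
    simp only [zero_add, pow_one, pow_zero, one_mul, one_smul]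
    exact hX
  | succ n ih =>
    have h := ih.mul hX
    simp only [← pow_succ] at h
    convert h using 1
    rw [smul_mul_assoc, mul_assoc, ← hc.eq, ← mul_assoc, ← pow_succ, succ_nsmul]

/-- A coefficient that is constant along the curve contributes nothing to the derivative. [cite: Salmhofer1998, §3.1 Prop. 1 proof (p.11; render p0011:L95-L139)] -/
theorem repr_eq_zero (hX : HasCoeffDerivAt X X' t) (s : Finset Γ)
    (hs : ∀ r, (grassmannBasis 𝕜 Γ).repr (X r) s = 0) : (grassmannBasis 𝕜 Γ).repr X' s = 0 := by
  have h := hX s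
  rw [show (fun r => (grassmannBasis 𝕜 Γ).repr (X r) s) = fun _ => (0 : 𝕜) from funext hs] at h
  exact h.unique (hasDerivAt_const t 0)

/-- **Parity passes to the derivative**: a curve of parity `i` has a derivative of parity `i`. [cite: Salmhofer1998, §3.1 Prop. 1 proof (p.11; render p0011:L95-L139)] -/
theorem mem_evenOdd (hX : HasCoeffDerivAt X X' t) {i : ZMod 2} (he : ∀ r, X r ∈ evenOdd 𝕜 i) :
    X' ∈ evenOdd 𝕜 i := by
  have hz : ∀ s : Finset Γ, (s.card : ZMod 2) ≠ i → (grassmannBasis 𝕜 Γ).repr X' s = 0 := fun s hs =>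
    hX.repr_eq_zero s fun r => repr_eq_zero_of_mem_evenOdd 𝕜 (he r) hs
  rw [← (grassmannBasis 𝕜 Γ).sum_repr X',
    ← Finset.sum_filter_add_sum_filter_not Finset.univ (fun s : Finset Γ => (s.card : ZMod 2) = i),
    Finset.sum_eq_zero (s := Finset.univ.filter fun s : Finset Γ => ¬((s.card : ZMod 2) = i))
      (fun s hs => by rw [hz s (Finset.mem_filter.1 hs).2, zero_smul]), add_zero]
  exact sum_smul_grassmannBasis_mem_evenOdd 𝕜 i _

/-- **No constant part along the curve ⇒ none in the derivative.** [cite: Salmhofer1998, §3.1 Prop. 1 proof (p.11; render p0011:L95-L139)] -/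
theorem constPart_eq_zero (hX : HasCoeffDerivAt X X' t) (h0 : ∀ r, constPart 𝕜 (X r) = 0) :
    constPart 𝕜 X' = 0 := by
  rw [constPart_eq_coord_empty, Module.Basis.coord_apply]
  exact hX.repr_eq_zero ∅ fun r => by rw [← Module.Basis.coord_apply, ← constPart_eq_coord_empty, h0 r]

/-- Changing the stated derivative along an equality. [cite: Salmhofer1998, §3.1 Prop. 1 proof (p.11; render p0011:L95-L139)] -/
theorem congr_deriv (hX : HasCoeffDerivAt X X' t) (h : X' = Y') : HasCoeffDerivAt X Y' t := h ▸ hX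

omit [NontriviallyNormedField 𝕂] [NormedAlgebra 𝕂 𝕜] [LinearOrder Γ] [Fintype Γ] in
/-- The exponential series differentiated term by term and re-summed: `Σ_{i ≤ N} (i!)⁻¹ · i · x^{i-1} y =
(Σ_{i < N} (i!)⁻¹ x^i) · y`. [cite: Salmhofer1998, §3.1 Prop. 1 proof (p.11; render p0011:L95-L139)] -/
theorem _root_.Literature.MathematicalPhysics.QuantumLattice.GrassmannAlgebra.sum_inv_factorial_smul_nsmul
    (x y : GrassmannAlgebra 𝕜 Γ) (N : ℕ) :
    ∑ i ∈ Finset.range (N + 1), ((i ! : ℚ)⁻¹) • (i • (x ^ (i - 1) * y)) =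
      (∑ i ∈ Finset.range N, ((i ! : ℚ)⁻¹) • x ^ i) * y := by
  rw [Finset.sum_range_succ', Finset.sum_mul]
  simp only [zero_smul, smul_zero, add_zero, Nat.add_sub_cancel, smul_mul_assoc]
  refine Finset.sum_congr rfl fun j _ => ?_
  rw [← Nat.cast_smul_eq_nsmul 𝕜 (j + 1), inv_factorial_succ_smul_succ_smul]

omit [NontriviallyNormedField 𝕂] [NormedAlgebra 𝕂 𝕜] [LinearOrder Γ] [Fintype Γ] in
/-- The logarithmic series differentiated term by term and re-summed:
`Σ_{k ≤ N} ((-1)^{k+1}/k) · k · x^{k-1} y = (Σ_{j < N} (-x)^j) · y`. [cite: Salmhofer1998, §3.1 Prop. 1 proof (p.11; render p0011:L95-L139)] -/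
theorem _root_.Literature.MathematicalPhysics.QuantumLattice.GrassmannAlgebra.sum_log_coeff_smul_nsmul
    (x y : GrassmannAlgebra 𝕜 Γ) (N : ℕ) :
    ∑ k ∈ Finset.range (N + 1), (((-1 : ℚ) ^ (k + 1)) / k) • (k • (x ^ (k - 1) * y)) =
      (∑ j ∈ Finset.range N, (-x) ^ j) * y := by
  rw [Finset.sum_range_succ', Finset.sum_mul]
  simp only [zero_smul, smul_zero, add_zero, Nat.add_sub_cancel]
  refine Finset.sum_congr rfl fun j _ => ?_
  have hj : ((j + 1 : ℕ) : ℚ) ≠ 0 := by positivity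
  rw [← Nat.cast_smul_eq_nsmul ℚ (j + 1), smul_smul, div_mul_cancel₀ _ hj, pow_succ, pow_succ, mul_assoc,
    neg_one_mul, neg_neg, mul_one, neg_pow x j, mul_assoc, Algebra.smul_def, map_pow, map_neg, map_one]

/-- **Derivative of the exponential along an even curve without constant part**:
`(e^{X})' = e^{X} X'` (the even element `X(t)` is central, so the classical chain rule holds).
[cite: Salmhofer1998, §3.1 Prop. 1 proof (p.11; render p0011:L95-L139)] -/
theorem grassmannExp (hX : HasCoeffDerivAt X X' t) (h0 : ∀ r, constPart 𝕜 (X r) = 0)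
    (he : ∀ r, X r ∈ evenOdd 𝕜 0) :
    HasCoeffDerivAt (fun r => QuantumLattice.grassmannExp (X r)) (QuantumLattice.grassmannExp (X t) * X') t := by
  set N := Fintype.card Γ + 1 with hN
  have hpow : ∀ r, X r ^ N = 0 := fun r => pow_card_succ_eq_zero_of_constPart_eq_zero 𝕜 (h0 r)
  have hpow' : ∀ r, X r ^ (N + 1) = 0 := fun r => by rw [pow_succ, hpow r, zero_mul]
  have hexp : ∀ r, QuantumLattice.grassmannExp (X r) = ∑ i ∈ Finset.range (N + 1), ((i ! : ℚ)⁻¹) • X r ^ i :=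
    fun r => IsNilpotent.exp_eq_sum (hpow' r)
  have hexpt : QuantumLattice.grassmannExp (X t) = ∑ i ∈ Finset.range N, ((i ! : ℚ)⁻¹) • X t ^ i :=
    IsNilpotent.exp_eq_sum (hpow t)
  rw [show (fun r => QuantumLattice.grassmannExp (X r)) = fun r => ∑ i ∈ Finset.range (N + 1), ((i ! : ℚ)⁻¹) • X r ^ i
    from funext hexp, hexpt, ← sum_inv_factorial_smul_nsmul]
  have hc : Commute (X t) X' := commute_of_mem_evenOdd_zero 𝕜 (he t) X'
  refine HasCoeffDerivAt.sum (Finset.range (N + 1)) fun i _ => ?_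
  rcases i with _ | j
  · simp only [pow_zero, zero_smul, smul_zero]
    exact hasCoeffDerivAt_const _ t
  · exact (hX.pow hc j).rat_smul _

/-- **Derivative of the logarithm along an even curve without constant part**:
`(log(1+X))' = (Σ_{j ≤ |Γ|} (-X)^j) · X'`, where the finite geometric sum is the inverse of `1 + X(t)`
(`one_add_mul_neg_geom_sum_eq_one`). [cite: Salmhofer1998, §3.1 Prop. 1 proof (p.11; render p0011:L95-L139)] -/
theorem grassmannLog1p (hX : HasCoeffDerivAt X X' t) (h0 : ∀ r, constPart 𝕜 (X r) = 0)
    (he : ∀ r, X r ∈ evenOdd 𝕜 0) :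
    HasCoeffDerivAt (fun r => QuantumLattice.grassmannLog1p 𝕜 (X r))
      ((∑ j ∈ Finset.range (Fintype.card Γ + 1), (-X t) ^ j) * X') t := by
  set N := Fintype.card Γ + 1 with hN
  have hpow : ∀ r, X r ^ N = 0 := fun r => pow_card_succ_eq_zero_of_constPart_eq_zero 𝕜 (h0 r)
  have hpow' : ∀ r, X r ^ (N + 1) = 0 := fun r => by rw [pow_succ, hpow r, zero_mul]
  have hlog : ∀ r, QuantumLattice.grassmannLog1p 𝕜 (X r) =
      ∑ k ∈ Finset.range (N + 1), (((-1 : ℚ) ^ (k + 1)) / k) • X r ^ k :=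
    fun r => grassmannLog1p_eq_sum 𝕜 (hpow' r)
  rw [show (fun r => QuantumLattice.grassmannLog1p 𝕜 (X r)) = fun r => ∑ k ∈ Finset.range (N + 1),
    (((-1 : ℚ) ^ (k + 1)) / k) • X r ^ k from funext hlog, ← sum_log_coeff_smul_nsmul]
  have hc : Commute (X t) X' := commute_of_mem_evenOdd_zero 𝕜 (he t) X'
  refine HasCoeffDerivAt.sum (Finset.range (N + 1)) fun k _ => ?_
  rcases k with _ | j
  · simp only [pow_zero, zero_smul, smul_zero]
    exact hasCoeffDerivAt_const _ t
  · exact (hX.pow hc j).rat_smul _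

omit [NontriviallyNormedField 𝕂] [NormedAlgebra 𝕂 𝕜] [LinearOrder Γ] in
/-- The finite geometric sum inverts `1 + x` for `x` without constant part: `(1 + x) Σ_{j ≤ |Γ|} (-x)^j = 1`.
[cite: Salmhofer1998, §3.1 Prop. 1 proof (p.11; render p0011:L95-L139)] -/
theorem _root_.Literature.MathematicalPhysics.QuantumLattice.GrassmannAlgebra.one_add_mul_neg_geom_sum_eq_one
    {x : GrassmannAlgebra 𝕜 Γ} (h0 : constPart 𝕜 x = 0) :
    (1 + x) * ∑ j ∈ Finset.range (Fintype.card Γ + 1), (-x) ^ j = 1 := by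
  have h := mul_neg_geom_sum (-x) (Fintype.card Γ + 1)
  rw [sub_neg_eq_add, neg_pow, pow_card_succ_eq_zero_of_constPart_eq_zero 𝕜 h0, mul_zero, sub_zero] at h
  exact h

end HasCoeffDerivAt

end GrassmannAlgebra

end CoeffDeriv

/-! ## §2 Uniform nilpotency of the fermionic Laplacian: `Δ_C ^ (|Γ| + 1) = 0` -/

section Nilpotency

variable (R : Type*) [CommRing R] [Algebra ℚ R] {Γ : Type*} [Fintype Γ]

/-- `Δ_C` lowers the degree by two: `Δ_C (⋀^{k+2}) ⊆ ⋀^k`. [cite: Salmhofer1998, §3.1 Prop. 1 proof, 'every application of Δ removes two fields' (render p0011:L133-L135)] -/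
theorem grassmannLaplacian_mem_exteriorPower (C : Matrix Γ Γ R) (k : ℕ) {a : GrassmannAlgebra R Γ}
    (ha : a ∈ ⋀[R]^(k + 2) (Γ → R)) : grassmannLaplacian R C a ∈ ⋀[R]^k (Γ → R) := by
  rw [grassmannLaplacian_apply]
  exact Submodule.smul_mem _ _ (Submodule.sum_mem _ fun X _ => Submodule.sum_mem _ fun Y _ =>
    Submodule.smul_mem _ _ (grassmannDeriv_mem_exteriorPower R X k
      (grassmannDeriv_mem_exteriorPower R Y (k + 1) ha)))

/-- `Δ_C` kills degrees `0` and `1`. [cite: Salmhofer1998, §3.1 Prop. 1 proof, 'every application of Δ removes two fields' (render p0011:L133-L135)] -/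
theorem grassmannLaplacian_eq_zero_of_mem_exteriorPower_le_one (C : Matrix Γ Γ R) {k : ℕ} (hk : k ≤ 1)
    {a : GrassmannAlgebra R Γ} (ha : a ∈ ⋀[R]^k (Γ → R)) : grassmannLaplacian R C a = 0 := by
  rw [ExteriorAlgebra.exteriorPower] at ha
  interval_cases k
  · rw [pow_zero, Submodule.mem_one] at ha
    obtain ⟨r, rfl⟩ := ha
    exact grassmannLaplacian_algebraMap R C r
  · rw [pow_one, LinearMap.mem_range] at ha
    obtain ⟨v, rfl⟩ := ha
    rw [grassmannLaplacian_apply]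
    simp [grassmannDeriv_ι]

/-- Powers of `Δ_C` on a homogeneous element: `Δ_C^m (⋀^k) = 0` as soon as `k < 2m`. [cite: Salmhofer1998, §3.1 Prop. 1 proof, 'every application of Δ removes two fields' (render p0011:L133-L135)] -/
theorem grassmannLaplacian_pow_apply_eq_zero_of_mem_exteriorPower (C : Matrix Γ Γ R) :
    ∀ (m k : ℕ) {a : GrassmannAlgebra R Γ}, a ∈ ⋀[R]^k (Γ → R) → k < 2 * m →
      (grassmannLaplacian R C ^ m) a = 0 := by
  intro m
  induction m with
  | zero => intro k a _ hk; omega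
  | succ m ih =>
    intro k a ha hk
    rw [pow_succ, Module.End.mul_apply]
    rcases Nat.lt_or_ge k 2 with h2 | h2
    · rw [grassmannLaplacian_eq_zero_of_mem_exteriorPower_le_one R C (by omega) ha, map_zero]
    · obtain ⟨k', rfl⟩ := Nat.exists_eq_add_of_le' h2
      exact ih k' (grassmannLaplacian_mem_exteriorPower R C k' ha) (by omega)

/-- **Uniform nilpotency of the fermionic Laplacian**: `Δ_C ^ (|Γ| + 1) = 0` for EVERY covariance `C` (each
application removes two fields; a uniform exponent is what a `t`-dependent covariance needs). [cite: Salmhofer1998, §3.1 Prop. 1 proof, 'every application of Δ removes two fields' (render p0011:L133-L135)] -/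
theorem grassmannLaplacian_pow_card_succ_eq_zero (C : Matrix Γ Γ R) :
    grassmannLaplacian R C ^ (Fintype.card Γ + 1) = 0 := by
  letI : LinearOrder Γ := LinearOrder.lift' (Fintype.equivFin Γ) (Fintype.equivFin Γ).injective
  refine (grassmannBasis R Γ).ext fun s => ?_
  rw [LinearMap.zero_apply]
  have hs : s.card ≤ Fintype.card Γ := Finset.card_le_univ s
  exact grassmannLaplacian_pow_apply_eq_zero_of_mem_exteriorPower R C _ _
    (grassmannBasis_mem_exteriorPower R s) (by omega)

/-- The Gaussian convolution as a FIXED-length exponential sum: `μ_C ⋆ = Σ_{i ≤ |Γ|+1} (i!)⁻¹ Δ_C^i`.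
[cite: Salmhofer1998, §3.1 Prop. 1 proof, 'every application of Δ removes two fields' (render p0011:L133-L135)] -/
theorem gaussConv_eq_sum_range (C : Matrix Γ Γ R) :
    gaussConv R C = ∑ i ∈ Finset.range (Fintype.card Γ + 2), ((i ! : ℚ)⁻¹) • grassmannLaplacian R C ^ i := by
  rw [gaussConv_def]
  refine IsNilpotent.exp_eq_sum ?_
  rw [pow_succ, grassmannLaplacian_pow_card_succ_eq_zero, zero_mul]

end Nilpotency

/-! ## §3 Salmhofer 1998, Proposition 1, first display: `∂_t (e^{Δ_{C_t}} F) = Δ_{Ċ_t} e^{Δ_{C_t}} F` -/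

section GaussConvDeriv

variable {𝕂 : Type*} [NontriviallyNormedField 𝕂] {𝕜 : Type*} [RCLike 𝕜] [NormedAlgebra 𝕂 𝕜]
variable {Γ : Type*} [LinearOrder Γ] [Fintype Γ]

namespace GrassmannAlgebra.HasCoeffDerivAt

/-- **The Laplacian of a differentiable covariance along a differentiable curve**:
`(Δ_{B(r)} H(r))' = Δ_{B'} H(t) + Δ_{B(t)} H'` (bilinearity of `(C, a) ↦ Δ_C a`). [cite: Salmhofer1998, §3.1 Prop. 1 (Geffdif) with proof (render p0011:L73-L76, L128-L131)] -/
theorem grassmannLaplacian {B : 𝕂 → Matrix Γ Γ 𝕜} {B' : Matrix Γ Γ 𝕜} {t : 𝕂}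
    (hB : ∀ X Y, HasDerivAt (fun r => B r X Y) (B' X Y) t) {H : 𝕂 → GrassmannAlgebra 𝕜 Γ}
    {H' : GrassmannAlgebra 𝕜 Γ} (hH : HasCoeffDerivAt H H' t) :
    HasCoeffDerivAt (fun r => QuantumLattice.grassmannLaplacian 𝕜 (B r) (H r))
      (QuantumLattice.grassmannLaplacian 𝕜 B' (H t) + QuantumLattice.grassmannLaplacian 𝕜 (B t) H') t := by
  simp only [grassmannLaplacian_apply]
  rw [← smul_add, ← Finset.sum_add_distrib]
  simp_rw [← Finset.sum_add_distrib]
  refine (HasCoeffDerivAt.sum Finset.univ fun X _ => HasCoeffDerivAt.sum Finset.univ fun Y _ => ?_).const_smul _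
  exact HasCoeffDerivAt.smul (hB X Y) (hH.linearMap (grassmannDeriv 𝕜 X ∘ₗ grassmannDeriv 𝕜 Y))

end GrassmannAlgebra.HasCoeffDerivAt

open GrassmannAlgebra.HasCoeffDerivAt in
/-- Powers of the Laplacian of a covariance vanishing at `t`: `(Δ_{B(r)}^{i+1} G)'|_{r=t} = Δ_{B'} Δ_{B(t)}^i G`
(`= Δ_{B'} G` for `i = 0`, `= 0` for `i ≥ 1`). [cite: Salmhofer1998, §3.1 Prop. 1 (Geffdif) with proof (render p0011:L73-L76, L128-L131)] -/
theorem hasCoeffDerivAt_grassmannLaplacian_pow_apply {B : 𝕂 → Matrix Γ Γ 𝕜} {B' : Matrix Γ Γ 𝕜} {t : 𝕂}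
    (hB : ∀ X Y, HasDerivAt (fun r => B r X Y) (B' X Y) t) (hB0 : B t = 0) (G : GrassmannAlgebra 𝕜 Γ) :
    ∀ i : ℕ, HasCoeffDerivAt (fun r => (grassmannLaplacian 𝕜 (B r) ^ (i + 1)) G)
      (grassmannLaplacian 𝕜 B' ((grassmannLaplacian 𝕜 (B t) ^ i) G)) t := by
  intro i
  induction i with
  | zero =>
    simp only [zero_add, pow_one, pow_zero, Module.End.one_apply]
    have h := (hasCoeffDerivAt_const G t).grassmannLaplacian hB
    rwa [map_zero, add_zero] at h
  | succ i ih =>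
    have h := ih.grassmannLaplacian hB
    simp only [← Module.End.mul_apply, ← pow_succ'] at h
    refine h.congr_deriv ?_
    rw [hB0, grassmannLaplacian_zero, zero_mul, LinearMap.zero_apply, add_zero, Module.End.mul_apply]

/-- **Derivative of the Gaussian convolution for a covariance vanishing at `t`**:
`(e^{Δ_{B(r)}} G)'|_{r=t} = Δ_{B'} G` when `B(t) = 0`. [cite: Salmhofer1998, §3.1 Prop. 1 (Geffdif) with proof (render p0011:L73-L76, L128-L131)] -/
theorem hasCoeffDerivAt_gaussConv_apply_of_eq_zero {B : 𝕂 → Matrix Γ Γ 𝕜} {B' : Matrix Γ Γ 𝕜} {t : 𝕂}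
    (hB : ∀ X Y, HasDerivAt (fun r => B r X Y) (B' X Y) t) (hB0 : B t = 0) (G : GrassmannAlgebra 𝕜 Γ) :
    HasCoeffDerivAt (fun r => gaussConv 𝕜 (B r) G) (grassmannLaplacian 𝕜 B' G) t := by
  simp only [gaussConv_eq_sum_range, LinearMap.coe_sum, Finset.sum_apply, LinearMap.smul_apply]
  have hsum : ∑ j ∈ Finset.range (Fintype.card Γ + 1), ((((j + 1) ! : ℕ) : ℚ)⁻¹) •
      grassmannLaplacian 𝕜 B' ((grassmannLaplacian 𝕜 (B t) ^ j) G) = grassmannLaplacian 𝕜 B' G := by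
    rw [Finset.sum_range_succ', hB0, grassmannLaplacian_zero, Finset.sum_eq_zero fun j _ => ?_]
    · simp
    · rw [pow_succ, mul_zero, LinearMap.zero_apply, map_zero, smul_zero]
  rw [show (fun r => ∑ i ∈ Finset.range (Fintype.card Γ + 2), ((i ! : ℚ)⁻¹) • (grassmannLaplacian 𝕜 (B r) ^ i) G)
      = fun r => (∑ j ∈ Finset.range (Fintype.card Γ + 1),
          ((((j + 1) ! : ℕ) : ℚ)⁻¹) • (grassmannLaplacian 𝕜 (B r) ^ (j + 1)) G) + ((0 ! : ℚ)⁻¹) • G from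
    funext fun r => by rw [Finset.sum_range_succ', pow_zero, Module.End.one_apply],
    ← add_zero (grassmannLaplacian 𝕜 B' G), ← hsum]
  exact (GrassmannAlgebra.HasCoeffDerivAt.sum _ fun j _ =>
    (hasCoeffDerivAt_grassmannLaplacian_pow_apply hB hB0 G j).rat_smul _).add (hasCoeffDerivAt_const _ t)

/-- **Salmhofer 1998, Proposition 1, first display (`Geffdif`)**: for an entrywise differentiable
covariance `t ↦ C_t` with derivative `Ċ_t` and any `F` in the finite Grassmann algebra,
`∂_t (e^{Δ_{C_t}} F) = Δ_{Ċ_t} (e^{Δ_{C_t}} F)` — coefficientwise in the monomial basis.  With `F = e^{𝒢(0,ψ)}`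
this is `∂_t e^{𝒢(t,ψ)} = Δ̇_{C_t} e^{𝒢(t,ψ)}`; the second display `e^{𝒢(t,ψ)} = e^{Δ_{C_t}} e^{𝒢(0,ψ)}` is the
tree's DEFINITION of the Gaussian convolution (`gaussConv_def`, `effBoltzmann_def`; Salmhofer 1999 Prop. 4.3).
Proof as printed: "since `Δ_{C_t}` also commutes with `Δ̇_{C_t}`" — here `e^{Δ_{C_r}} = e^{Δ_{C_r − C_t}} e^{Δ_{C_t}}`
(`gaussConv_add`) and the first-order term of the fixed-length exponential sum. [cite: Salmhofer1998, Prop. 1 p.11 (render p0011:L62-L80)] -/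
theorem hasCoeffDerivAt_gaussConv_apply {C : 𝕂 → Matrix Γ Γ 𝕜} {C' : Matrix Γ Γ 𝕜} {t : 𝕂}
    (hC : ∀ X Y, HasDerivAt (fun r => C r X Y) (C' X Y) t) (F : GrassmannAlgebra 𝕜 Γ) :
    HasCoeffDerivAt (fun r => gaussConv 𝕜 (C r) F) (grassmannLaplacian 𝕜 C' (gaussConv 𝕜 (C t) F)) t := by
  have h := hasCoeffDerivAt_gaussConv_apply_of_eq_zero (B := fun r => C r - C t) (B' := C') (t := t)
    (fun X Y => by simpa only [Matrix.sub_apply] using (hC X Y).sub_const (C t X Y)) (sub_self _)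
    (gaussConv 𝕜 (C t) F)
  rwa [show (fun r => gaussConv 𝕜 (C r - C t) (gaussConv 𝕜 (C t) F)) = fun r => gaussConv 𝕜 (C r) F from
    funext fun r => by rw [← gaussConv_add_apply, sub_add_cancel]] at h

/-- The same with a differentiable argument: `(e^{Δ_{C_r}} F_r)' = Δ_{Ċ} e^{Δ_{C_t}} F_t + e^{Δ_{C_t}} F'`.
[cite: Salmhofer1998, §3.1 Prop. 1 (Geffdif) with proof (render p0011:L73-L76, L128-L131)] -/
theorem GrassmannAlgebra.HasCoeffDerivAt.gaussConv {C : 𝕂 → Matrix Γ Γ 𝕜} {C' : Matrix Γ Γ 𝕜} {t : 𝕂}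
    (hC : ∀ X Y, HasDerivAt (fun r => C r X Y) (C' X Y) t) {F : 𝕂 → GrassmannAlgebra 𝕜 Γ}
    {F' : GrassmannAlgebra 𝕜 Γ} (hF : HasCoeffDerivAt F F' t) :
    HasCoeffDerivAt (fun r => QuantumLattice.gaussConv 𝕜 (C r) (F r))
      (QuantumLattice.grassmannLaplacian 𝕜 C' (QuantumLattice.gaussConv 𝕜 (C t) (F t)) +
        QuantumLattice.gaussConv 𝕜 (C t) F') t := by
  have key : ∀ (M : Matrix Γ Γ 𝕜) (x : GrassmannAlgebra 𝕜 Γ), QuantumLattice.gaussConv 𝕜 M x =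
      ∑ s, (grassmannBasis 𝕜 Γ).repr x s • QuantumLattice.gaussConv 𝕜 M (grassmannBasis 𝕜 Γ s) := fun M x => by
    conv_lhs => rw [← (grassmannBasis 𝕜 Γ).sum_repr x]
    simp only [map_sum, map_smul]
  rw [show (fun r => QuantumLattice.gaussConv 𝕜 (C r) (F r)) = fun r => ∑ s, (grassmannBasis 𝕜 Γ).repr (F r) s •
      QuantumLattice.gaussConv 𝕜 (C r) (grassmannBasis 𝕜 Γ s) from funext fun r => key _ _]
  have h := GrassmannAlgebra.HasCoeffDerivAt.sum Finset.univ fun s _ =>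
    HasCoeffDerivAt.smul (hF s) (hasCoeffDerivAt_gaussConv_apply hC (grassmannBasis 𝕜 Γ s))
  refine h.congr_deriv ?_
  rw [Finset.sum_add_distrib, add_comm, ← key (C t) F']
  congr 1
  rw [key (C t) (F t), map_sum]
  simp only [map_smul]

end GaussConvDeriv

/-! ## §4 The Laplacian of the exponential of an even element -/

section LaplaceExp

variable (R : Type*) [CommRing R] {Γ : Type*} [Fintype Γ]

/-- **Salmhofer's bilinear form of the RGE**: `grassmannDerivPairing C a b = Σ_{X,Y} ∂_X a · C(X,Y) · ∂_Y b`, i.e.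
`(δa/δψ, C δb/δψ)_Γ` of Salmhofer 1998, (RGE) in Prop. 1 / Salmhofer 1999, (4.89), in the tree's weight-free
convention for `∫_Γ dX` and `δ/δψ` (see `GrassmannLaplacian.lean`, Design). [cite: Salmhofer1998, Prop. 1 (RGE) p.11 (render p0011:L86-L93)] -/
def grassmannDerivPairing (C : Matrix Γ Γ R) (a b : GrassmannAlgebra R Γ) : GrassmannAlgebra R Γ :=
  ∑ X, ∑ Y, C X Y • (grassmannDeriv R X a * grassmannDeriv R Y b)

/-- Unfolding `grassmannDerivPairing`. [cite: Salmhofer1998, §3.1 Prop. 1 (RGE) (render p0011:L82-L93)] -/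
theorem grassmannDerivPairing_apply (C : Matrix Γ Γ R) (a b : GrassmannAlgebra R Γ) :
    grassmannDerivPairing R C a b = ∑ X, ∑ Y, C X Y • (grassmannDeriv R X a * grassmannDeriv R Y b) := rfl

/-- `grassmannDerivPairing` only sees the field-dependent part: adding scalars changes nothing. [cite: Salmhofer1998, §3.1 Prop. 1 (RGE) (render p0011:L82-L93)] -/
theorem grassmannDerivPairing_algebraMap_add (C : Matrix Γ Γ R) (c c' : R) (a b : GrassmannAlgebra R Γ) :
    grassmannDerivPairing R C (algebraMap R _ c + a) (algebraMap R _ c' + b) = grassmannDerivPairing R C a b := by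
  simp only [grassmannDerivPairing, map_add, grassmannDeriv_algebraMap, zero_add]

/-- `grassmannDerivPairing` is even in the pair of signs: `(δ(-a)/δψ, C δ(-b)/δψ) = (δa/δψ, C δb/δψ)`. [cite: Salmhofer1998, §3.1 Prop. 1 (RGE) (render p0011:L82-L93)] -/
theorem grassmannDerivPairing_neg_neg (C : Matrix Γ Γ R) (a b : GrassmannAlgebra R Γ) :
    grassmannDerivPairing R C (-a) (-b) = grassmannDerivPairing R C a b := by
  simp only [grassmannDerivPairing, map_neg, neg_mul_neg]

variable [Algebra ℚ R]

/-- **The Laplacian of an exponential** ("performing the derivatives with respect to `ψ`", Salmhofer 1998,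
end of the proof of Prop. 1): for an even nilpotent `g`,
`Δ_C e^{g} = e^{g} · (Δ_C g + ½ (δg/δψ, C δg/δψ)_Γ)` — from `∂_Y e^{g} = e^{g} ∂_Y g` and the Leibniz rule
for the even factor `e^{g}`. [cite: Salmhofer1998, Prop. 1 proof p.11 (render p0011:L133-L139)] -/
theorem grassmannLaplacian_grassmannExp (C : Matrix Γ Γ R) {g : GrassmannAlgebra R Γ} (hg : g ∈ evenOdd R 0)
    (hn : IsNilpotent g) :
    grassmannLaplacian R C (grassmannExp g) =
      grassmannExp g * (grassmannLaplacian R C g + ((1 / 2 : ℚ) • (1 : R)) • grassmannDerivPairing R C g g) := by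
  have he : grassmannExp g ∈ evenOdd R 0 := grassmannExp_mem_evenOdd_zero R hg hn
  rw [grassmannLaplacian_apply, grassmannLaplacian_apply, grassmannDerivPairing, mul_add, mul_smul_comm, mul_smul_comm,
    ← smul_add, Finset.mul_sum, Finset.mul_sum, ← Finset.sum_add_distrib]
  congr 1
  refine Finset.sum_congr rfl fun X _ => ?_
  rw [Finset.mul_sum, Finset.mul_sum, ← Finset.sum_add_distrib]
  refine Finset.sum_congr rfl fun Y _ => ?_
  rw [grassmannDeriv_grassmannExp_of_mem_evenOdd_zero R Y hg hn, grassmannDeriv_mul_of_mem_evenOdd_zero R X he,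
    grassmannDeriv_grassmannExp_of_mem_evenOdd_zero R X hg hn, smul_add, mul_smul_comm, mul_smul_comm, mul_assoc,
    add_comm]

end LaplaceExp

/-! ## §5 Salmhofer 1998, Proposition 1: the renormalization group equation -/

section RGE

variable {𝕂 : Type*} [NontriviallyNormedField 𝕂] {𝕜 : Type*} [RCLike 𝕜] [NormedAlgebra 𝕂 𝕜]
variable {Γ : Type*} [LinearOrder Γ] [Fintype Γ]

open GrassmannAlgebra.HasCoeffDerivAt

omit [LinearOrder Γ] in
/-- The rational `½` of `grassmannLaplacian` is the field element `2⁻¹`. [cite: Salmhofer1998, §3.1 (Geff1)-(RGE) (render p0011:L40-L93)] -/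
theorem one_half_smul_one_eq_inv_two : ((1 / 2 : ℚ) • (1 : 𝕜)) = (2 : 𝕜)⁻¹ := by
  rw [Rat.smul_one_eq_cast]; push_cast; ring

/-- **Salmhofer 1998, Proposition 1 (`Geffdif`) for the effective Boltzmann factor**
`e^{𝒢(t,ψ)} = μ_{C_t} ⋆ e^{-V}` of the tree (`effBoltzmann`, `𝒢(0,ψ) = -V(ψ)`):
`∂_t e^{𝒢(t,ψ)} = Δ̇_{C_t} e^{𝒢(t,ψ)}`, with `Δ̇_{C_t} = Δ_{Ċ_t}` the Laplacian of the derivative of the covariance.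
[cite: Salmhofer1998, Prop. 1 (Geffdif) p.11 (render p0011:L73-L76)] -/
theorem hasCoeffDerivAt_effBoltzmann_flow {C : 𝕂 → Matrix Γ Γ 𝕜} {C' : Matrix Γ Γ 𝕜} {t : 𝕂}
    (hC : ∀ X Y, HasDerivAt (fun r => C r X Y) (C' X Y) t) (V : GrassmannAlgebra 𝕜 Γ) :
    HasCoeffDerivAt (fun r => effBoltzmann 𝕜 (C r) V)
      (grassmannLaplacian 𝕜 C' (effBoltzmann 𝕜 (C t) V)) t := by
  simp only [effBoltzmann_def]
  exact hasCoeffDerivAt_gaussConv_apply hC _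

/-- The normalised partition function `Z_t = ∫ dμ_{C_t} e^{-V}` is differentiable along the flow, with
`Ż_t = [Δ_{Ċ_t} e^{𝒢(t,·)}]_∅` (the constant part of `Geffdif`). [cite: Salmhofer1998, Prop. 1 (Geffdif) p.11 (render p0011:L73-L76)] -/
theorem hasDerivAt_effPartitionFn_flow {C : 𝕂 → Matrix Γ Γ 𝕜} {C' : Matrix Γ Γ 𝕜} {t : 𝕂}
    (hC : ∀ X Y, HasDerivAt (fun r => C r X Y) (C' X Y) t) (V : GrassmannAlgebra 𝕜 Γ) :
    HasDerivAt (fun r => effPartitionFn 𝕜 (C r) V)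
      (constPart 𝕜 (grassmannLaplacian 𝕜 C' (effBoltzmann 𝕜 (C t) V))) t :=
  (hasCoeffDerivAt_effBoltzmann_flow hC V).apply (constPart 𝕜).toLinearMap

omit [NontriviallyNormedField 𝕂] [NormedAlgebra 𝕂 𝕜] [LinearOrder Γ] [Fintype Γ] in
/-- The truncated logarithm of an element without constant part has no constant part. [cite: Salmhofer1998, §3.1 (Geff1)-(RGE) (render p0011:L40-L93)] -/
theorem constPart_grassmannLog1p {x : GrassmannAlgebra 𝕜 Γ} (h0 : constPart 𝕜 x = 0) :
    constPart 𝕜 (grassmannLog1p 𝕜 x) = 0 := by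
  rw [grassmannLog1p, map_sum]
  refine Finset.sum_eq_zero fun k _ => ?_
  rw [map_rat_smul (constPart 𝕜 (Γ := Γ)), map_pow, h0]
  rcases k with _ | k
  · simp
  · rw [zero_pow (Nat.succ_ne_zero k), smul_zero]

/-- **Salmhofer 1998, Proposition 1 — the renormalization group equation, normalised form.**  Let
`t ↦ C_t` be an entrywise differentiable covariance with derivative `Ċ = C'` at `t`, `V` an even interaction
without constant part, and assume the partition function `Z_t = ∫ dμ_{C_t} e^{-V}` does not vanish at `t` (it is
then non-zero near `t`).  Then the tree's normalised effective action `𝒱_r = effAction (C r) V`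
(`e^{𝒢(r,ψ)} = Z_r e^{-𝒱_r}`, i.e. `𝒢(r,ψ) = log Z_r − 𝒱_r(ψ)`) is coefficientwise differentiable at `t` with
`∂_t 𝒱 = Δ_{Ċ} 𝒱 − ½ (δ𝒱/δψ, Ċ δ𝒱/δψ)_Γ − [Δ_{Ċ} 𝒱 − ½ (δ𝒱/δψ, Ċ δ𝒱/δψ)_Γ]_∅ · 1`,
and `Ż_t = −Z_t · [Δ_{Ċ} 𝒱_t − ½ (δ𝒱_t/δψ, Ċ δ𝒱_t/δψ)_Γ]_∅` — Salmhofer's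
`∂_t 𝒢 = Δ̇ 𝒢 + ½ (δ𝒢/δψ, Ċ δ𝒢/δψ)` for `𝒢 = log Z − 𝒱` split into its field-dependent and constant parts (the
unsplit form is `hasCoeffDerivAt_salmhofer_rge`).  Proof as printed ("performing the derivatives with respect to
`ψ` gives (RGE)"): `∂_t e^{𝒢} = Δ_{Ċ} e^{𝒢}` (`hasCoeffDerivAt_effBoltzmann_flow`),
`Δ_{Ċ} e^{g} = e^{g}(Δ_{Ċ} g + ½(δg, Ċ δg))` (`grassmannLaplacian_grassmannExp`) and the chain rule for `log` on the
even subalgebra. [cite: Salmhofer1998, Prop. 1 (RGE) p.11 (render p0011:L82-L93)] -/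
theorem hasCoeffDerivAt_effAction_flow {C : 𝕂 → Matrix Γ Γ 𝕜} {C' : Matrix Γ Γ 𝕜} {t : 𝕂}
    (hC : ∀ X Y, HasDerivAt (fun r => C r X Y) (C' X Y) t) {V : GrassmannAlgebra 𝕜 Γ}
    (hV0 : constPart 𝕜 V = 0) (hVe : V ∈ evenOdd 𝕜 0) (hZt : effPartitionFn 𝕜 (C t) V ≠ 0) :
    HasCoeffDerivAt (fun r => effAction 𝕜 (C r) V)
      (grassmannLaplacian 𝕜 C' (effAction 𝕜 (C t) V)
        - (2 : 𝕜)⁻¹ • grassmannDerivPairing 𝕜 C' (effAction 𝕜 (C t) V) (effAction 𝕜 (C t) V)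
        - constPart 𝕜 (grassmannLaplacian 𝕜 C' (effAction 𝕜 (C t) V)
            - (2 : 𝕜)⁻¹ • grassmannDerivPairing 𝕜 C' (effAction 𝕜 (C t) V) (effAction 𝕜 (C t) V)) • 1) t ∧
    HasDerivAt (fun r => effPartitionFn 𝕜 (C r) V)
      (-(effPartitionFn 𝕜 (C t) V * constPart 𝕜 (grassmannLaplacian 𝕜 C' (effAction 𝕜 (C t) V)
        - (2 : 𝕜)⁻¹ • grassmannDerivPairing 𝕜 C' (effAction 𝕜 (C t) V) (effAction 𝕜 (C t) V)))) t := by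
  -- notation
  set E : 𝕂 → GrassmannAlgebra 𝕜 Γ := fun r => effBoltzmann 𝕜 (C r) V with hEdef
  set Z : 𝕂 → 𝕜 := fun r => effPartitionFn 𝕜 (C r) V with hZdef
  set W : GrassmannAlgebra 𝕜 Γ := effAction 𝕜 (C t) V with hWdef
  set z' : 𝕜 := constPart 𝕜 (grassmannLaplacian 𝕜 C' (E t)) with hz'def
  set q : 𝕜 := (2 : 𝕜)⁻¹ with hqdef
  have hq : ((1 / 2 : ℚ) • (1 : 𝕜)) = q := one_half_smul_one_eq_inv_two
  -- nilpotency and parity bookkeeping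
  have hnV : IsNilpotent (-V) := isNilpotent_of_constPart_eq_zero 𝕜 (by rw [map_neg, hV0, neg_zero])
  have hexpV : grassmannExp (-V) ∈ evenOdd 𝕜 0 := grassmannExp_mem_evenOdd_zero 𝕜 (neg_mem hVe) hnV
  have hEe : ∀ r, E r ∈ evenOdd 𝕜 0 := fun r => gaussConv_mem_evenOdd 𝕜 (C r) hexpV
  have hZu : IsUnit (Z t) := isUnit_iff_ne_zero.2 hZt
  have hW0 : constPart 𝕜 W = 0 := constPart_effAction 𝕜 (C t) V hZu
  have hWe : W ∈ evenOdd 𝕜 0 := mem_evenPart_iff.1 (effAction_mem_evenPart (C t) (mem_evenPart_iff.2 hVe) hV0)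
  have hnW : IsNilpotent W := isNilpotent_of_constPart_eq_zero 𝕜 hW0
  have hnW' : IsNilpotent (-W) := isNilpotent_of_constPart_eq_zero 𝕜 (by rw [map_neg, hW0, neg_zero])
  -- (a) the Boltzmann factor and the partition function
  have hE : HasCoeffDerivAt E (grassmannLaplacian 𝕜 C' (E t)) t := hasCoeffDerivAt_effBoltzmann_flow hC V
  have hZ' : HasDerivAt Z z' t := hasDerivAt_effPartitionFn_flow hC V
  have hEt : E t = Z t • grassmannExp (-W) := effBoltzmann_eq_smul_grassmannExp 𝕜 (C t) V hZu
  have hZconst : ∀ r, constPart 𝕜 (E r) = Z r := fun r => rfl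
  -- (b) the normalised Boltzmann factor minus one, `x_r = Z_r⁻¹ (e^{𝒢(r)} - Z_r) (= e^{-𝒱_r} - 1 where Z_r ≠ 0)`
  set x : 𝕂 → GrassmannAlgebra 𝕜 Γ := fun r => (Z r)⁻¹ • (E r - Z r • 1) with hxdef
  have hZinv : HasDerivAt (fun r => (Z r)⁻¹) (-z' / Z t ^ 2) t := by
    have h := (hasDerivAt_const t (1 : 𝕜)).div hZ' hZt
    simp only [zero_mul, zero_sub, one_mul] at h
    refine (h.congr_of_eventuallyEq (Filter.Eventually.of_forall fun r => ?_)).congr_deriv (by rw [neg_div])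
    simp only [Pi.div_apply, one_div]
  have hx : HasCoeffDerivAt x ((-z' / Z t ^ 2) • (E t - Z t • 1) +
      (Z t)⁻¹ • (grassmannLaplacian 𝕜 C' (E t) - z' • 1)) t :=
    HasCoeffDerivAt.smul hZinv (hE.sub (hasCoeffDerivAt_smul_const hZ' 1))
  have hx0 : ∀ r, constPart 𝕜 (x r) = 0 := fun r => by
    simp only [hxdef, map_sub, map_smul, map_one, smul_eq_mul, mul_one, hZconst, sub_self, mul_zero]
  have hxe : ∀ r, x r ∈ evenOdd 𝕜 0 := fun r =>
    Submodule.smul_mem _ _ (sub_mem (hEe r) (Submodule.smul_mem _ _ (one_mem_evenOdd_zero 𝕜)))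
  have hxt : 1 + x t = grassmannExp (-W) := by
    simp only [hxdef]
    rw [hEt, ← smul_sub, smul_smul, inv_mul_cancel₀ hZt, one_smul, add_sub_cancel]
  -- (c) near `t` the effective action is `-log (1 + x)`
  have hVx : (fun r => effAction 𝕜 (C r) V) =ᶠ[𝓝 t] fun r => -grassmannLog1p 𝕜 (x r) := by
    filter_upwards [hZ'.continuousAt.eventually_ne hZt] with r hr
    simp only [hxdef]
    rw [effAction_def, Ring.inverse_eq_inv', smul_sub, smul_smul, inv_mul_cancel₀ hr, one_smul]
  -- (d) the chain rule for the logarithm; the geometric sum is `e^{𝒱_t}`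
  have hlog := (hx.grassmannLog1p hx0 hxe).neg
  have hfe : grassmannExp W * grassmannExp (-W) = 1 := IsNilpotent.exp_mul_exp_neg_self hnW
  have hS : ∑ j ∈ Finset.range (Fintype.card Γ + 1), (-x t) ^ j = grassmannExp W := by
    have h1 : (1 + x t) * ∑ j ∈ Finset.range (Fintype.card Γ + 1), (-x t) ^ j = 1 :=
      one_add_mul_neg_geom_sum_eq_one (hx0 t)
    have h2 : grassmannExp W * (1 + x t) = 1 := by rw [hxt]; exact hfe
    exact (left_inv_eq_right_inv h2 h1).symm
  -- (e) the Laplacian of `e^{-𝒱}`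
  have hLap : grassmannLaplacian 𝕜 C' (grassmannExp (-W)) =
      grassmannExp (-W) * (-grassmannLaplacian 𝕜 C' W + q • grassmannDerivPairing 𝕜 C' W W) := by
    rw [grassmannLaplacian_grassmannExp 𝕜 C' (neg_mem hWe) hnW', map_neg, grassmannDerivPairing_neg_neg, hq]
  -- (f) assemble: the derivative of `-log(1 + x)` is `Δ W - q P + (z'/Z) 1`
  have hzz : -z' / Z t ^ 2 * Z t = -(z' / Z t) := by
    rw [neg_div, neg_mul, pow_two, div_mul_eq_mul_div, mul_div_mul_right _ _ hZt]
  have hx' : (-z' / Z t ^ 2) • (E t - Z t • 1) + (Z t)⁻¹ • (grassmannLaplacian 𝕜 C' (E t) - z' • 1) =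
      grassmannExp (-W) * (-grassmannLaplacian 𝕜 C' W + q • grassmannDerivPairing 𝕜 C' W W) -
        (z' / Z t) • grassmannExp (-W) := by
    rw [hEt, map_smul, hLap, ← smul_sub (Z t), smul_smul, hzz, smul_sub ((Z t)⁻¹), smul_smul, smul_smul,
      inv_mul_cancel₀ hZt, one_smul, inv_mul_eq_div, smul_sub, neg_smul, neg_smul]
    abel
  have hder : HasCoeffDerivAt (fun r => -grassmannLog1p 𝕜 (x r))
      (grassmannLaplacian 𝕜 C' W - q • grassmannDerivPairing 𝕜 C' W W + (z' / Z t) • 1) t := by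
    refine hlog.congr_deriv ?_
    rw [hS, hx', mul_sub, mul_smul_comm, ← mul_assoc, hfe, one_mul]
    abel
  -- (g) the subtracted constant is `-[Δ W - q P]_∅` because `log (1 + x)` has no constant part along the curve
  have hκ : z' / Z t = -constPart 𝕜 (grassmannLaplacian 𝕜 C' W - q • grassmannDerivPairing 𝕜 C' W W) := by
    have h0 := hder.constPart_eq_zero fun r => by
      rw [map_neg, constPart_grassmannLog1p (hx0 r), neg_zero]
    rw [map_add, map_smul, map_one, smul_eq_mul, mul_one] at h0
    linear_combination h0
  refine ⟨(hder.congr_of_eventuallyEq hVx).congr_deriv ?_, hZ'.congr_deriv ?_⟩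
  · rw [hκ, neg_smul, ← sub_eq_add_neg]
  · have hz : z' = Z t * (z' / Z t) := by rw [mul_comm, div_mul_cancel₀ _ hZt]
    rw [hz, hκ, mul_neg]

/-- **Salmhofer 1998, Proposition 1 — the RGE as printed.**  With `𝒢(r,ψ) = c(r) − 𝒱_r(ψ)`, where `c` is any
scalar function with `ċ(t) = Ż_t/Z_t` (a local logarithm of the partition function to first order; the value of
`Ż_t/Z_t` is the one of `hasCoeffDerivAt_effAction_flow`), the effective action satisfies
`∂_t 𝒢(t,ψ) = Δ_{Ċ_t} 𝒢(t,ψ) + ½ (δ𝒢/δψ, Ċ_t δ𝒢/δψ)_Γ` coefficientwise — Salmhofer's (RGE)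
(`Δ̇_{C_t} = Δ_{Ċ_t}`; the tree's weight-free conventions for `∫dX`, `δ/δψ`, see `GrassmannLaplacian.lean`).
The parity clause of Prop. 1 ("`𝒢(t,ψ)` is an element of the even subalgebra") is the tree's
`effAction_mem_evenPart`. [cite: Salmhofer1998, Prop. 1 (RGE) p.11 (render p0011:L82-L93)] -/
theorem hasCoeffDerivAt_salmhofer_rge {C : 𝕂 → Matrix Γ Γ 𝕜} {C' : Matrix Γ Γ 𝕜} {t : 𝕂}
    (hC : ∀ X Y, HasDerivAt (fun r => C r X Y) (C' X Y) t) {V : GrassmannAlgebra 𝕜 Γ}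
    (hV0 : constPart 𝕜 V = 0) (hVe : V ∈ evenOdd 𝕜 0) (hZt : effPartitionFn 𝕜 (C t) V ≠ 0)
    {c : 𝕂 → 𝕜} {c' : 𝕜} (hc : HasDerivAt c c' t)
    (hc' : c' = -constPart 𝕜 (grassmannLaplacian 𝕜 C' (effAction 𝕜 (C t) V)
            - (2 : 𝕜)⁻¹ • grassmannDerivPairing 𝕜 C' (effAction 𝕜 (C t) V) (effAction 𝕜 (C t) V))) :
    HasCoeffDerivAt (fun r => algebraMap 𝕜 (GrassmannAlgebra 𝕜 Γ) (c r) - effAction 𝕜 (C r) V)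
      (grassmannLaplacian 𝕜 C' (algebraMap 𝕜 _ (c t) - effAction 𝕜 (C t) V)
        + (2 : 𝕜)⁻¹ • grassmannDerivPairing 𝕜 C'
            (algebraMap 𝕜 _ (c t) - effAction 𝕜 (C t) V) (algebraMap 𝕜 _ (c t) - effAction 𝕜 (C t) V)) t := by
  have h1 : HasCoeffDerivAt (fun r => algebraMap 𝕜 (GrassmannAlgebra 𝕜 Γ) (c r)) (c' • 1) t := by
    simp only [Algebra.algebraMap_eq_smul_one]
    exact hasCoeffDerivAt_smul_const hc 1
  refine (h1.sub (hasCoeffDerivAt_effAction_flow hC hV0 hVe hZt).1).congr_deriv ?_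
  have hΔ : grassmannLaplacian 𝕜 C' (algebraMap 𝕜 (GrassmannAlgebra 𝕜 Γ) (c t) - effAction 𝕜 (C t) V) =
      -grassmannLaplacian 𝕜 C' (effAction 𝕜 (C t) V) := by
    rw [map_sub, grassmannLaplacian_algebraMap, zero_sub]
  have hP : grassmannDerivPairing 𝕜 C' (algebraMap 𝕜 (GrassmannAlgebra 𝕜 Γ) (c t) - effAction 𝕜 (C t) V)
      (algebraMap 𝕜 (GrassmannAlgebra 𝕜 Γ) (c t) - effAction 𝕜 (C t) V) =
      grassmannDerivPairing 𝕜 C' (effAction 𝕜 (C t) V) (effAction 𝕜 (C t) V) := by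
    rw [sub_eq_add_neg, grassmannDerivPairing_algebraMap_add, grassmannDerivPairing_neg_neg]
  rw [hΔ, hP, hc', neg_smul]
  abel

end RGE




end Literature.MathematicalPhysics.QuantumLattice
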